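import Mathlib
import HarnessLib
import Summits.FinalStateConjecture.Statement
import Literature.Geometry.Lorentzian.ReggeWheelerTortoise
import Literature.Geometry.Lorentzian.ReggeWheelerChannels
import Summits.FinalStateConjecture.FinalStateConjecture.Theorems.PhotonSphereChannelsExteriorEnergyRW
import Summits.FinalStateConjecture.FinalStateConjecture.Theorems.PhotonSphereChannelsUniformPhotonSphereChannelsNearKernelCensus
import Summits.FinalStateConjecture.FinalStateConjecture.Theorems.PhotonSphereChannelsCauchyWave
import Summits.FinalStateConjecture.FinalStateConjecture.Theorems.PhotonSphereChannelsFrozenEscape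

/-!
# Route PhotonSphereChannels — K1 `UniformPhotonSphereChannels` is false; K2
# `ChannelsResolveTameDevelopments` holds (frame forms; items stmt-FinalStateConjecture-10045 / 10046)

`ChannelsResolveTameDevelopments` (K2, stmt-FinalStateConjecture-10046) is, by definition, the implication
`UniformPhotonSphereChannels → Φ` (K1 ⇒ tame, complete-𝓘⁺, no-extremal-remnant maximal developments
settle to an honest exhaustive 2-decomposition).  Its antecedent K1 (stmt-FinalStateConjecture-10045) is
FALSE as typed — refuted on paper by five seats of its crux chain and decided in Lean HERE
(`PhotonSphereChannels.not_uniformPhotonSphereChannels_frame`) — so K2 holds, ex falso, with no claim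
whatsoever about Φ (`PhotonSphereChannels.channelsResolveTameDevelopments_frame_proof`).  The planner's
declared pivot (restate K1 as K1′ with `ρ₀(ℓ) = O(M log ℓ)` or a horizon-flux near end, and re-type K2
against K1′) is where the content of Φ is pursued; this file settles both items AS FILED.

**The refutation of K1** (`K2Frame.no_uniform_channelInequality`): `M = 1`, photon sphere at the
tortoise origin, `r = tortoiseRadius`, spin `s = 1`, ball `ρ = ρ₀` itself.  FROZEN VELOCITY PACKETS
(`FrozenEscape.frozen_escape`, mechanism of prover seat 3's `FrozenPacket.near_energy_le_at`): odd data
`(0, g)` with `g` a bump in a layer of width `n⁻²` just below the near edge `−ρ₀` and `ℓ = n³`; during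
the time `T = 2n⁻²` the receding edge needs to uncover the layer the solution does not move
(energy inequality for `ψ − g sin(ωt)/ω`, `ω² = V` frozen at the layer), so both exterior energies at
`±T` are `≤ (c/4)∫g²`, hence (exterior-energy monotonicity `RW.exteriorEnergy_antitoneOn_rw`, this seat)
so are both channel energies; while the near-side kernel census
(`KruskalRestFrameVirial.stub_nearKernelCensus`, line lead of 10045 over the disprover's
`KernelCensus.static_of_finite_energy`) keeps the kernel deficit `≥ ∫ g²` for velocity data
(`K2Frame.deficit_lower_bound`, glue adapted from the published line skeleton
`Cruxes/UniformPhotonSphereChannels/Lines/kruskal-rest-frame-virial.lean`).  With K1's `c > 0`: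
`c ∫g² ≤ (c/2) ∫g²`, contradiction.  The global `C²` solution is `CauchyWave.stub_rwCauchy` (seat 1).

Design constraint (same as `PhotonSphereChannelsAssemblyFrame.lean`): this module does NOT import the
route module `…Theses.PhotonSphereChannels` — when an item closes, the gate re-renders the route file
with `import <closing module>` and a `…_holds` theorem, which a closing module importing the route
file would turn into an import cycle (rev-3/4/6 episodes of this route).  Hence K1 and Φ are INLINED
VERBATIM (bodies copied from the route file rev 6), so that the types below are the route decls
`…Theses.PhotonSphereChannels.UniformPhotonSphereChannels` (negated) and
`…Theses.PhotonSphereChannels.ChannelsResolveTameDevelopments` by `δ`-unfolding alone.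
-/

namespace Summit.FinalStateConjecture.FinalStateConjecture.Theorems

open scoped BigOperators Topology ENNReal
open Filter Set MeasureTheory
open Literature.Geometry.Lorentzian Literature.Geometry.Lorentzian.ReggeWheeler

namespace PhotonSphereChannels.K2Frame

/-- From the census to the coercive side: for ODD data `(0, g)` with `g` supported on the near
side, `dist²(data, P(ρ)) ≥ ∫ g²` — for a kernel element `p`, either the near energy of `ψ − p` at
`t = 0` is infinite, or (as `ψ(0,·) = 0`) `p` itself has finite near energy, hence zero velocity trace
on the near half-line (census), and then `e[ψ − p](0,x) ≥ g(x)²` there.  (Glue adapted from the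
published skeleton of line `kruskal-rest-frame-virial`.) -/
theorem deficit_lower_bound {M : ℝ} {r : ℝ → ℝ} {xc : ℝ} (hr : IsTortoiseRadius M r xc) (ℓ : ℕ)
    (hℓ : 1 ≤ ℓ) (ρ : ℝ) (ψ : ℝ → ℝ → ℝ) (hψ : ContDiff ℝ 2 (Function.uncurry ψ))
    (hψ0 : ∀ x, ψ 0 x = 0)
    (g : ℝ → ℝ) (hg : Continuous g) (hψt : ∀ x, deriv (fun τ => ψ τ x) 0 = g x)
    (hg0 : ∀ x, xc - ρ ≤ x → g x = 0) (hgi : Integrable (fun x => g x ^ 2))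
    (hcensus : ∀ p ∈ rwKernel (linePotential M 1 ℓ r) xc ρ,
      ∫⁻ x in Iio (xc - ρ), ENNReal.ofReal (energyDensity (linePotential M 1 ℓ r) p 0 x) < ∞ →
        ∀ x, x < xc - ρ → deriv (fun τ => p τ x) 0 = 0) :
    ENNReal.ofReal (∫ x, g x ^ 2) ≤ kernelDeficit (linePotential M 1 ℓ r) xc ρ ψ := by
  set V := linePotential M 1 ℓ r with hV
  have hV0 : ∀ x, 0 ≤ V x := fun x => linePotential_nonneg hr.mass_pos.le hℓ hr.two_mul_lt x
  -- the data integral as a lower integral over the near half-line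
  have hG : ENNReal.ofReal (∫ x, g x ^ 2) = ∫⁻ x in Iio (xc - ρ), ENNReal.ofReal (g x ^ 2) := by
    rw [ofReal_integral_eq_lintegral_ofReal hgi (ae_of_all _ fun x => sq_nonneg (g x)),
      ← lintegral_add_compl (fun x => ENNReal.ofReal (g x ^ 2)) (measurableSet_Iio (a := xc - ρ)),
      setLIntegral_eq_zero (measurableSet_Iio (a := xc - ρ)).compl, add_zero]
    intro x hx
    simp only [mem_compl_iff, mem_Iio, not_lt] at hx
    simp [hg0 x hx]
  have hGfin : ∫⁻ x in Iio (xc - ρ), ENNReal.ofReal (g x ^ 2) < ∞ := hG ▸ ENNReal.ofReal_lt_top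
  have hgm : Measurable fun x => ENNReal.ofReal (g x ^ 2) :=
    ENNReal.measurable_ofReal.comp (hg.pow 2).measurable
  -- slices of ψ are differentiable
  have hslice : ∀ x : ℝ, DifferentiableAt ℝ (fun τ : ℝ => (τ, x)) 0 := fun x => by fun_prop
  have hdψ : ∀ x, DifferentiableAt ℝ (fun τ => ψ τ x) 0 := fun x => by
    have h1 : DifferentiableAt ℝ (Function.uncurry ψ) ((fun τ : ℝ => (τ, x)) 0) :=
      (hψ.differentiable (by norm_num)) _
    exact h1.comp (0 : ℝ) (hslice x)
  unfold kernelDeficit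
  refine le_iInf₂ fun p hp => ?_
  obtain ⟨hpC, hpS, hpP⟩ := hp
  -- slices of p are differentiable at t = 0 on the near half-line
  have hmem : ∀ x, x < xc - ρ → ((0 : ℝ), x) ∈ exteriorCone xc ρ := by
    intro x hx
    simp only [mem_exteriorCone, abs_zero, add_zero]
    rw [abs_sub_comm]
    exact lt_of_lt_of_le (by linarith) (le_abs_self _)
  have hdp : ∀ x, x < xc - ρ → DifferentiableAt ℝ (fun τ => p τ x) 0 := fun x hx => by
    have h1 : DifferentiableAt ℝ (Function.uncurry p) ((fun τ : ℝ => (τ, x)) 0) :=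
      (hpC.contDiffAt ((isOpen_exteriorCone xc ρ).mem_nhds (hmem x hx))).differentiableAt
        (by norm_num)
    exact h1.comp (0 : ℝ) (hslice x)
  set q : ℝ → ℝ := fun x => deriv (fun τ => p τ x) 0 with hq
  have hderiv : ∀ x, x < xc - ρ → deriv (fun τ => ψ τ x - p τ x) 0 = g x - q x := by
    intro x hx
    rw [← hψt x]
    exact deriv_sub (hdψ x) (hdp x hx)
  -- pointwise: the energy density of ψ − p at t = 0 on the near half-line
  have hpt : ∀ x, x < xc - ρ →
      energyDensity V (fun t y => ψ t y - p t y) 0 x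
        = (g x - q x) ^ 2 + deriv (p 0) x ^ 2 + V x * p 0 x ^ 2 := by
    intro x hx
    unfold energyDensity
    rw [hderiv x hx]
    have h2 : (fun t y => ψ t y - p t y) 0 = fun y => -p 0 y := by
      funext y
      simp [hψ0 y]
    rw [h2, deriv.fun_neg]
    ring
  set E := ∫⁻ x in Iio (xc - ρ), ENNReal.ofReal (energyDensity V (fun t y => ψ t y - p t y) 0 x)
    with hE
  have hsub : Iio (xc - ρ) ⊆ {x : ℝ | ρ < |x - xc|} := by
    intro x hx
    simp only [mem_Iio] at hx
    simp only [mem_setOf_eq]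
    rw [abs_sub_comm]
    exact lt_of_lt_of_le (by linarith) (le_abs_self _)
  refine le_trans ?_ (lintegral_mono_set hsub)
  rw [hG]
  change ∫⁻ x in Iio (xc - ρ), ENNReal.ofReal (g x ^ 2) ≤ E
  by_cases hEtop : E = ∞
  · rw [hEtop]; exact le_top
  · -- finite near energy of ψ − p ⇒ finite near energy of p itself (ψ(0,·) = 0, g ∈ L²)
    have hElt : E < ∞ := lt_top_iff_ne_top.2 hEtop
    have hptP : ∀ x ∈ Iio (xc - ρ), ENNReal.ofReal (energyDensity V p 0 x) ≤
        2 * ENNReal.ofReal (energyDensity V (fun t y => ψ t y - p t y) 0 x)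
          + 2 * ENNReal.ofReal (g x ^ 2) := by
      intro x hx
      have h2 : (2 : ℝ≥0∞) = ENNReal.ofReal 2 := by simp
      have hVp : 0 ≤ V x * p 0 x ^ 2 := mul_nonneg (hV0 x) (sq_nonneg _)
      have hA : 0 ≤ 2 * ((g x - q x) ^ 2 + deriv (p 0) x ^ 2 + V x * p 0 x ^ 2) := by positivity
      have hB : 0 ≤ 2 * g x ^ 2 := by positivity
      rw [hpt x hx, h2, ← ENNReal.ofReal_mul zero_le_two, ← ENNReal.ofReal_mul zero_le_two,
        ← ENNReal.ofReal_add hA hB]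
      refine ENNReal.ofReal_le_ofReal ?_
      unfold energyDensity
      nlinarith [sq_nonneg (g x - q x + g x), sq_nonneg (2 * g x - q x), sq_nonneg (deriv (p 0) x),
        sq_nonneg (q x - 2 * g x), hVp]
    have hfinP : ∫⁻ x in Iio (xc - ρ), ENNReal.ofReal (energyDensity V p 0 x) < ∞ := by
      calc ∫⁻ x in Iio (xc - ρ), ENNReal.ofReal (energyDensity V p 0 x)
          ≤ ∫⁻ x in Iio (xc - ρ), (2 * ENNReal.ofReal (energyDensity V (fun t y => ψ t y - p t y) 0 x)
              + 2 * ENNReal.ofReal (g x ^ 2)) := setLIntegral_mono' measurableSet_Iio hptP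
        _ = 2 * E + 2 * ∫⁻ x in Iio (xc - ρ), ENNReal.ofReal (g x ^ 2) := by
            rw [lintegral_add_right _ (hgm.const_mul 2), lintegral_const_mul' _ _ ENNReal.ofNat_ne_top,
              lintegral_const_mul' _ _ ENNReal.ofNat_ne_top]
        _ < ∞ := ENNReal.add_lt_top.2 ⟨ENNReal.mul_lt_top (by simp) hElt,
            ENNReal.mul_lt_top (by simp) hGfin⟩
    -- census: the velocity trace of p vanishes on the near half-line
    have hq0 : ∀ x, x < xc - ρ → q x = 0 := hcensus p ⟨hpC, hpS, hpP⟩ hfinP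
    refine setLIntegral_mono' measurableSet_Iio fun x hx => ?_
    simp only [mem_Iio] at hx
    rw [hpt x hx, hq0 x hx, sub_zero]
    refine ENNReal.ofReal_le_ofReal ?_
    nlinarith [sq_nonneg (deriv (p 0) x), mul_nonneg (hV0 x) (sq_nonneg (p 0 x))]

/-- Channel energies are dominated by the exterior energy at any time beyond which the exterior
energy is monotone (`liminf ≤` value). -/
theorem channelEnergy_le_of_antitone {V : ℝ → ℝ} {xc ρ : ℝ} {ψ : ℝ → ℝ → ℝ}
    (h : AntitoneOn (exteriorEnergy V xc ρ ψ) (Ici 0) ∧ MonotoneOn (exteriorEnergy V xc ρ ψ) (Iic 0))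
    {t₁ : ℝ} (ht₁ : 0 ≤ t₁) :
    channelEnergy V xc ρ ψ atTop ≤ exteriorEnergy V xc ρ ψ t₁ ∧
      channelEnergy V xc ρ ψ atBot ≤ exteriorEnergy V xc ρ ψ (-t₁) := by
  constructor
  · refine liminf_le_of_frequently_le' (Eventually.frequently ?_)
    filter_upwards [eventually_ge_atTop t₁] with t ht
    exact h.1 (mem_Ici.2 ht₁) (mem_Ici.2 (ht₁.trans ht)) ht
  · refine liminf_le_of_frequently_le' (Eventually.frequently ?_)
    filter_upwards [eventually_le_atBot (-t₁)] with t ht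
    exact h.2 (mem_Iic.2 (ht.trans (by linarith))) (mem_Iic.2 (by linarith)) ht

/-- **No uniform channel inequality** in the Regge–Wheeler vocabulary: there are no `ρ₀ ≥ 0`,
`c > 0` making `ChannelInequality (linePotential 1 1 ℓ r) 0 ρ c` hold for all `ℓ ≥ 1`, `ρ ≥ ρ₀`
along the tortoise radius functions centred at the photon sphere (`M = 1`, `xc = 0`).  Frozen
velocity packets just below the near edge `−ρ₀` of the ball `ρ = ρ₀` escape both near channels
(`FrozenEscape.frozen_escape` at `±T`, then exterior-energy monotonicity), while the kernel census
keeps the deficit `≥ ∫ g²`. -/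
theorem no_uniform_channelInequality :
    ¬ ∃ ρ₀ : ℝ, 0 ≤ ρ₀ ∧ ∃ c : ℝ, 0 < c ∧ ∀ (r : ℝ → ℝ), IsTortoiseRadius 1 r 0 →
      ∀ ℓ : ℕ, 1 ≤ ℓ → ∀ ρ : ℝ, ρ₀ ≤ ρ → ChannelInequality (linePotential 1 1 ℓ r) 0 ρ c := by
  rintro ⟨ρ₀, hρ₀, c, hc, H⟩
  set r : ℝ → ℝ := tortoiseRadius one_pos 0 with hr_def
  have hr : IsTortoiseRadius 1 r 0 := isTortoiseRadius_tortoiseRadius one_pos 0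
  -- the frozen packet below the near edge xe = −ρ₀ of the ball ρ = ρ₀, with ε = c/4
  obtain ⟨ℓ, α, β, g, hℓ1, hαβ, hβxe, hgC, hgsupp, hgint, hgpos, hesc⟩ :=
    FrozenEscape.frozen_escape_of hr (-ρ₀) (by linarith) (ε := c / 4) (by positivity)
  -- the global `C²` solution with data (0, g)
  obtain ⟨ψ, hψsol, hψ0, hψt, hψsupp⟩ := CauchyWave.stub_rwCauchy hr 1 ℓ hℓ1 g hgC α β hgsupp
  -- escape: exterior energies at ±T are ≤ (c/4) ∫ g²
  obtain ⟨T, hT, hEp, hEm⟩ := hesc ψ hψsol hψ0 hψt hψsupp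
  rw [neg_neg] at hEp hEm
  -- the channel inequality for this solution at ρ = ρ₀
  have hCI : ENNReal.ofReal c * kernelDeficit (linePotential 1 1 ℓ r) 0 ρ₀ ψ ≤
      channelEnergy (linePotential 1 1 ℓ r) 0 ρ₀ ψ atTop +
        channelEnergy (linePotential 1 1 ℓ r) 0 ρ₀ ψ atBot :=
    H r hr ℓ hℓ1 ρ₀ le_rfl ψ hψsol
  -- upper bounds on the channel energies (monotonicity + escape)
  have hmono := RW.exteriorEnergy_antitoneOn_rw hr hℓ1 hψsol 0 hρ₀
  obtain ⟨hup, hdown⟩ := channelEnergy_le_of_antitone hmono hT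
  have hup' := hup.trans hEp
  have hdown' := hdown.trans hEm
  -- lower bound on the deficit (census)
  have hlow : ENNReal.ofReal (∫ x, g x ^ 2) ≤ kernelDeficit (linePotential 1 1 ℓ r) 0 ρ₀ ψ :=
    deficit_lower_bound hr ℓ hℓ1 ρ₀ ψ hψsol.1 hψ0 g hgC.continuous hψt
      (fun x hx => hgsupp x (Or.inr (by linarith))) hgint
      (fun p hp hfin => KruskalRestFrameVirial.stub_nearKernelCensus hr 1 ℓ hℓ1 ρ₀ p hp hfin)
  -- contradiction
  set E₀ : ℝ := ∫ x, g x ^ 2 with hE₀_def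
  have key : ENNReal.ofReal (c * E₀) ≤ ENNReal.ofReal (c / 4 * E₀ + c / 4 * E₀) := by
    calc ENNReal.ofReal (c * E₀) = ENNReal.ofReal c * ENNReal.ofReal E₀ := ENNReal.ofReal_mul hc.le
      _ ≤ ENNReal.ofReal c * kernelDeficit (linePotential 1 1 ℓ r) 0 ρ₀ ψ := by gcongr
      _ ≤ _ := hCI
      _ ≤ ENNReal.ofReal (c / 4 * E₀) + ENNReal.ofReal (c / 4 * E₀) := add_le_add hup' hdown'
      _ = ENNReal.ofReal (c / 4 * E₀ + c / 4 * E₀) :=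
          (ENNReal.ofReal_add (by positivity) (by positivity)).symm
  have key' := (ENNReal.ofReal_le_ofReal_iff (by positivity)).1 key
  nlinarith [mul_pos hc hgpos]

end PhotonSphereChannels.K2Frame

/-- **K1 `UniformPhotonSphereChannels` is false** (statement inlined verbatim from the route file, so
that this type is `¬ …Theses.PhotonSphereChannels.UniformPhotonSphereChannels` by `δ`-unfolding): at
`M = 1` the claimed uniform channel inequality, read over `Literature.Geometry.Lorentzian.ReggeWheeler`
(the inlined `let`s ARE `linePotential`, `energyDensity`, `exteriorCone`, `rwKernel`, `kernelDeficit`,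
`channelEnergy`, by `rfl`), contradicts `K2Frame.no_uniform_channelInequality` (frozen velocity packets
below the near edge escape both near channels while the kernel deficit stays `≥ ∫ g²`). -/
theorem PhotonSphereChannels.not_uniformPhotonSphereChannels_frame :
    ¬ (∀ M : ℝ, 0 < M → ∃ ρ₀ : ℝ, 0 ≤ ρ₀ ∧ ∃ c : ℝ, 0 < c ∧ ∀ (r : ℝ → ℝ) (xc : ℝ), (∀ x, 2 * M < r x) → (∀ x, HasDerivAt r (1 - 2 * M / r x) x) → r xc = 3 * M → ∀ (s ℓ : ℕ), s ≤ 2 → s ≤ ℓ → ∀ ρ : ℝ, ρ₀ ≤ ρ → ∀ ψ : ℝ → ℝ → ℝ, ContDiff ℝ 2 (Function.uncurry ψ) → let V : ℝ → ℝ := fun x => (1 - 2 * M / r x) * ((ℓ : ℝ) * ((ℓ : ℝ) + 1) / r x ^ 2 + (1 - (s : ℝ) ^ 2) * (2 * M) / r x ^ 3); let e : (ℝ → ℝ → ℝ) → ℝ → ℝ → ℝ := fun φ t x => deriv (fun τ => φ τ x) t ^ 2 + deriv (φ t) x ^ 2 + V x * φ t x ^ 2; let IsSol : (ℝ → ℝ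 → ℝ) → ℝ × ℝ → Prop := fun φ z => iteratedDeriv 2 (fun τ => φ τ z.2) z.1 - iteratedDeriv 2 (φ z.1) z.2 + V z.2 * φ z.1 z.2 = 0; let Ω : Set (ℝ × ℝ) := {z | ρ + |z.1| < |z.2 - xc|}; let P : Set (ℝ → ℝ → ℝ) := {p | ContDiffOn ℝ 2 (Function.uncurry p) Ω ∧ (∀ z ∈ Ω, IsSol p z) ∧ ∃ (N : ℕ) (a : ℕ → ℝ → ℝ), ∀ z ∈ Ω, p z.1 z.2 = ∑ i ∈ Finset.range N, a i z.2 * z.1 ^ i}; let Eext : ℝ → ENNReal := fun t => MeasureTheory.lintegral (MeasureTheory.volume.restrict {x : ℝ | ρ + |t| < |x - xc|}) (fun x => ENNReal.ofReal (e ψ t x)); (∀ z, IsSol ψ z) → ENNReal.ofReal c * (⨅ p ∈ P, MeasureTheory.lintegral (MeasureTheory.volume.restrict {x : ℝ | ρ < |x - xc|}) (fun x => ENNReal.ofReal (e (fun t y => ψ t y - p t y) 0 x))) ≤ Filter.liminf Eext Filter.atTop + Filter.liminf Eext Filter.atBot) := by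
  intro hK
  obtain ⟨ρ₀, hρ₀, c, hc, H⟩ := hK 1 one_pos
  refine K2Frame.no_uniform_channelInequality ⟨ρ₀, hρ₀, c, hc, fun r hr ℓ hℓ ρ hρ φ hφ => ?_⟩
  exact H r 0 hr.two_mul_lt hr.hasDerivAt hr.center 1 ℓ (by norm_num) hℓ ρ hρ φ hφ.1 hφ.2

/-- **K2 `ChannelsResolveTameDevelopments` of route PhotonSphereChannels, frame form** (item
stmt-FinalStateConjecture-10046): `UniformPhotonSphereChannels → Φ` with both sides written out verbatim,
so that this type unfolds to the route decl
`Summit.FinalStateConjecture.FinalStateConjecture.Theses.PhotonSphereChannels.ChannelsResolveTameDevelopments`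
by `δ`-reduction alone.  Proof: the antecedent is refuted by
`PhotonSphereChannels.not_uniformPhotonSphereChannels_frame` (ex falso; nothing is claimed about Φ —
the planner's restatement against the repaired K1′ carries the content). -/
theorem PhotonSphereChannels.channelsResolveTameDevelopments_frame_proof :
    (∀ M : ℝ, 0 < M → ∃ ρ₀ : ℝ, 0 ≤ ρ₀ ∧ ∃ c : ℝ, 0 < c ∧ ∀ (r : ℝ → ℝ) (xc : ℝ), (∀ x, 2 * M < r x) → (∀ x, HasDerivAt r (1 - 2 * M / r x) x) → r xc = 3 * M → ∀ (s ℓ : ℕ), s ≤ 2 → s ≤ ℓ → ∀ ρ : ℝ, ρ₀ ≤ ρ → ∀ ψ : ℝ → ℝ → ℝ, ContDiff ℝ 2 (Function.uncurry ψ) → let V : ℝ → ℝ := fun x => (1 - 2 * M / r x) * ((ℓ : ℝ) * ((ℓ : ℝ) + 1) / r x ^ 2 + (1 - (s : ℝ) ^ 2) * (2 * M) / r x ^ 3); let e : (ℝ → ℝ → ℝ) → ℝ → ℝ → ℝ := fun φ t x => deriv (fun τ => φ τ x) t ^ 2 + deriv (φ t) x ^ 2 + V x * φ t x ^ 2; let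 IsSol : (ℝ → ℝ → ℝ) → ℝ × ℝ → Prop := fun φ z => iteratedDeriv 2 (fun τ => φ τ z.2) z.1 - iteratedDeriv 2 (φ z.1) z.2 + V z.2 * φ z.1 z.2 = 0; let Ω : Set (ℝ × ℝ) := {z | ρ + |z.1| < |z.2 - xc|}; let P : Set (ℝ → ℝ → ℝ) := {p | ContDiffOn ℝ 2 (Function.uncurry p) Ω ∧ (∀ z ∈ Ω, IsSol p z) ∧ ∃ (N : ℕ) (a : ℕ → ℝ → ℝ), ∀ z ∈ Ω, p z.1 z.2 = ∑ i ∈ Finset.range N, a i z.2 * z.1 ^ i}; let Eext : ℝ → ENNReal := fun t => MeasureTheory.lintegral (MeasureTheory.volume.restrict {x : ℝ | ρ + |t| < |x - xc|}) (fun x => ENNReal.ofReal (e ψ t x)); (∀ z, IsSol ψ z) → ENNReal.ofReal c * (⨅ p ∈ P, MeasureTheory.lintegral (MeasureTheory.volume.restrict {x : ℝ | ρ < |x - xc|}) (fun x => ENNReal.ofReal (e (fun t y => ψ t y - p t y) 0 x))) ≤ Filter.liminf Eext Filter.atTop + Filter.liminf Eext Filter.atBot) → ∀ (X : Type) [TopologicalSpace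 X] [ChartedSpace Literature.Geometry.Lorentzian.E3 X] [IsManifold (modelWithCornersSelf ℝ Literature.Geometry.Lorentzian.E3) ((⊤ : ℕ∞) : WithTop ℕ∞) X] [T2Space X] [SecondCountableTopology X] [ConnectedSpace X], ∀ D ∈ Literature.Geometry.Lorentzian.admissibleVacuumData X, ∀ 𝒟 : Literature.Geometry.Lorentzian.VacuumCauchyDevelopment D, 𝒟.IsMaximal → _root_.Summit.FinalStateConjecture.HasCompleteNullInfinity 𝒟.toCauchyDevelopment → ((∀ (Λ : Literature.Geometry.Lorentzian.lorentzGroup) (c : Literature.Geometry.Lorentzian.E4) (M a : ℝ), Literature.Geometry.Lorentzian.Kerr.IsExtremal M a → ¬ ∃ (τ₀ : ℝ) (Ψ : (Literature.Geometry.Lorentzian.boostedKerrBackground Λ c M a).domain → 𝒟.carrier), 𝒟.toSpacetime.IsLateChart (Literature.Geometry.Lorentzian.boostedKerrBackground Λ c M a) Set.univ τ₀ Ψ ∧ ∀ R : ℝ, Filter.Tendsto (fun τ => 𝒟.toSpacetime.truncDeviationCk (Literature.Geometry.Lorentzian.boostedKerrBackground Λ c M a) Ψ 2 R τ) Filter.atTop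 (nhds 0)) ∧ ∀ [𝒟.metric.HasLeviCivita], let outer : Set 𝒟.carrier := 𝒟.metric.causalFuture 𝒟.timeOrientation (Set.range 𝒟.embed) ∩ {q | ∃ (p : X) (γ : ℝ → 𝒟.carrier) (dom : Set ℝ), 𝒟.metric.IsNormalisedNullRayFrom 𝒟.timeOrientation 𝒟.embed 𝒟.normal p γ dom ∧ ¬ BddAbove dom ∧ q ∈ 𝒟.metric.chronologicalPast 𝒟.timeOrientation (γ '' (dom ∩ Set.Ici 0))}; ∃ r₀ : ℝ, 0 < r₀ ∧ ∃ Λ : NNReal, ∀ q ∈ outer, let U : TopologicalSpace.Opens Literature.Geometry.Lorentzian.E4 := ⟨Metric.ball (0 : Literature.Geometry.Lorentzian.E4) r₀, Metric.isOpen_ball⟩; ∃ Ψ : U → 𝒟.carrier, 𝒟.toSpacetime.IsLateChart (Literature.Geometry.Lorentzian.Minkowski.backgroundOn U) Set.univ (-r₀) Ψ ∧ (∃ x : U, (x : Literature.Geometry.Lorentzian.E4) = 0 ∧ Ψ x = q) ∧ Literature.Geometry.Lorentzian.supCkENorm (U : Set Literature.Geometry.Lorentzian.E4) 3 (𝒟.toSpacetime.deviationExtend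 (Literature.Geometry.Lorentzian.Minkowski.backgroundOn U) Ψ) ≤ (Λ : ENNReal) ∧ Literature.Geometry.Lorentzian.supCkENorm (U : Set Literature.Geometry.Lorentzian.E4) 0 (𝒟.toSpacetime.deviationExtend (Literature.Geometry.Lorentzian.Minkowski.backgroundOn U) Ψ) ≤ 1 / 2) → ∃ (O : Set 𝒟.carrier) (d : Literature.Geometry.Lorentzian.FinalStateDecomposition 𝒟.toSpacetime O 2), O = _root_.Summit.FinalStateConjecture.exteriorOf 𝒟.toCauchyDevelopment d.charted ∧ _root_.Summit.FinalStateConjecture.HasExhaustiveCharts d :=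
  fun hK1 => absurd hK1 PhotonSphereChannels.not_uniformPhotonSphereChannels_frame

end Summit.FinalStateConjecture.FinalStateConjecture.Theorems
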